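import Summits.Ventures.Crystal3D.Bulk.GapOrientedFaces
import Summits.Ventures.Crystal3D.Bulk.GapRhombus
import Summits.Ventures.Crystal3D.Bulk.GapKite
import HarnessLib

/-!
# Small faces of the two-level tight map: a face of length `3` is a tight triangle (R-tri gives
# all its corners), a face of length `4` is a tight quadrilateral (R-rhomb / R-quad-p apply)
# (`phase2/LEAN-FACES-DESIGN.md` (F1) ⇒ the LP's face rows for `m ≤ 4`)

HONEST FRAMING. Part of the venture `Summits/Ventures/Crystal3D` (cell `pub-crystal3d`, phase 2;
seat typer-bulk-2). `Bulk/GapOrientedFaces.lean` makes the faces of the DRAWN tight map (orbits of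
the consistently oriented face successor `ofaceSucc c` on the darts, `Bulk/GapOrientation.lean`)
first-class finsets with their corner sums `ofaceAngleSum`; `Bulk/GapOrientedDarts.lean`
identifies the corner of a face at a dart with the LP's corner variable (`ofaceCorner = odartGap`,
`=` the geometric `corner` under the census socket). The census LP (DESIGN-L12-THEORY §P-L4 C) has FACE rows by face size: R-tri for
triangles, R-rhomb for shell rhombi, R-quad-p for the kites at the hole. The geometric identities
are in the tree FACE-FREE (`Bulk/GapCorners.lean`, `Bulk/GapRhombus.lean`, `Bulk/GapKite.lean`);
THIS file attaches them to the combinatorial faces: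

* `ofaceAngleSum_ofaceOf` — the corner sum of the face through `q` is
  `Σ_{n < ofaceLen} ofaceCorner (φ^[n] q)`;
* faces of length `3` (`CensusRows.oface_three`): the darts are `(i,j), (j,k), (k,i)` with
  `i, j, k` pairwise tight — a tight triangle; its corners are `corner c j k i`, `corner c k i j`,
  `corner c i j k` (`CensusRows.ofaceCorner_oface_three`), hence **R-tri on faces**:
  `CensusRows.ofaceAngleSum_three_shell` (an x-triangle face has corner sum `3·arccos (1/3)`) and
  `CensusRows.ofaceAngleSum_three_hole` (a p-triangle face through the hole dart `(13, j)` has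
  corner sum `A_p + 2·A_x`);
* faces of length `4` (`CensusRows.oface_four`): darts `(i,j), (j,k), (k,l), (l,i)` with the four
  vertices PAIRWISE DISTINCT and consecutive ones tight — a tight quadrilateral; **R-rhomb on
  faces** (`CensusRows.ofaceCorner_oface_four_opposite_shell`: in an all-shell quadrilateral face
  opposite corners are equal, and `cos` of a corner is `(4⟪u_k, u_i⟫ − 1)/3` in the diagonal,
  `CensusRows.cos_ofaceCorner_oface_four_shell`) and **R-quad-p on faces**
  (`CensusRows.ofaceCorner_oface_four_kite`: in a quadrilateral face through the hole dart
  `(13, j)` the corners at the two shell neighbours `j`, `l` of the hole are equal).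

Nothing is claimed about GAP(1.26); faces of length `≥ 5`, the face-size upper bounds
(P-L3(c)) and Lemma L are NOT here.
-/

noncomputable section

open scoped BigOperators InnerProductSpace
open Finset Function

namespace Summit.Ventures.Crystal3D

variable {c : Fin 14 → EuclideanSpace ℝ (Fin 3)}

/-! ## Walking along a face -/

/-- The tail of the next dart is the head of the current one. -/
theorem ofaceSucc_fst (c : Fin 14 → EuclideanSpace ℝ (Fin 3)) (q : Fin 14 × Fin 14) :
    (ofaceSucc c q).1 = q.2 := rfl

/-- The head of the next dart is the next tight partner of the head after the tail. -/
theorem ofaceSucc_snd (c : Fin 14 → EuclideanSpace ℝ (Fin 3)) (q : Fin 14 × Fin 14) :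
    (ofaceSucc c q).2 = onextNbr c q.2 q.1 := rfl

/-- A dart joins distinct touching balls other than ball `0`. -/
theorem dart_data {q : Fin 14 × Fin 14} (hq : q ∈ darts c) :
    q.1 ≠ 0 ∧ q.2 ≠ 0 ∧ q.1 ≠ q.2 ∧ dist (c q.1) (c q.2) = 1 :=
  mem_darts.1 hq

/-- **The corner sum of the face through `q` read along the walk**:
`ofaceAngleSum c (ofaceOf c q) = Σ_{n < ofaceLen c q} ofaceCorner c (φ^[n] q)`. -/
theorem ofaceAngleSum_ofaceOf (c : Fin 14 → EuclideanSpace ℝ (Fin 3)) (q : Fin 14 × Fin 14) :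
    ofaceAngleSum c (ofaceOf c q) =
      ∑ n ∈ Finset.range (ofaceLen c q), ofaceCorner c ((ofaceSucc c)^[n] q) := by
  unfold ofaceAngleSum ofaceOf
  rw [Finset.sum_image]
  intro m hm n hn hmn
  rw [Finset.coe_range, Set.mem_Iio] at hm hn
  exact iterate_injOn_Iio_minimalPeriod hm hn hmn

/-- Under the census socket the face corner at the head `j` of a dart `(i, j)` is the geometric
corner `corner c j (onextNbr c j i) i` between the incoming arc and the next arc. -/
theorem CensusRows.ofaceCorner_eq_corner_onextNbr (h : CensusRows c) {q : Fin 14 × Fin 14} (hq : q ∈ darts c) :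
    ofaceCorner c q = corner c q.2 (onextNbr c q.2 q.1) q.1 :=
  (h.ofaceCorner_eq_corner hq).1

/-! ## Faces of length three are tight triangles -/

/-- **A face of length `3` is a tight triangle.** Under the census socket, if the face through
the dart `q = (i, j)` has length `3` and `k` is the head of the next dart, then the third dart is
`(k, i)`, the three balls `i, j, k` are pairwise distinct and pairwise at distance `1`, and the
rotation closes up: `onextNbr c j i = k`, `onextNbr c k j = i`, `onextNbr c i k = j`. -/
theorem CensusRows.oface_three (h : CensusRows c) {q : Fin 14 × Fin 14} (hq : q ∈ darts c)
    (h3 : ofaceLen c q = 3) :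
    ofaceSucc c (ofaceSucc c q) = ((ofaceSucc c q).2, q.1) ∧
      q.1 ≠ (ofaceSucc c q).2 ∧ dist (c (ofaceSucc c q).2) (c q.1) = 1 ∧
      dist (c q.2) (c (ofaceSucc c q).2) = 1 ∧
      onextNbr c (ofaceSucc c q).2 q.2 = q.1 ∧ onextNbr c q.1 (ofaceSucc c q).2 = q.2 := by
  obtain ⟨hD3, -, -⟩ := h.intruderDist_bounds
  have hg := h.isGapConfig
  have hfix := iterate_ofaceLen c q
  rw [h3] at hfix
  change ofaceSucc c (ofaceSucc c (ofaceSucc c q)) = q at hfix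
  have hq1 := hg.ofaceSucc_mem_darts hD3 hq
  have hq2 := hg.ofaceSucc_mem_darts hD3 hq1
  -- the third dart ends at `q.1`
  have hl : (ofaceSucc c (ofaceSucc c q)).2 = q.1 := by
    have := congrArg Prod.fst hfix
    rwa [ofaceSucc_fst] at this
  have h2 : ofaceSucc c (ofaceSucc c q) = ((ofaceSucc c q).2, q.1) := Prod.ext rfl hl
  rw [h2] at hq2 hfix
  obtain ⟨-, -, hki, hdki⟩ := dart_data hq2
  obtain ⟨-, -, -, hdjk⟩ := dart_data hq1
  rw [ofaceSucc_fst] at hdjk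
  refine ⟨h2, Ne.symm hki, hdki, hdjk, ?_, ?_⟩
  · have := congrArg Prod.snd h2
    rw [ofaceSucc_snd, ofaceSucc_fst] at this
    exact this
  · have := congrArg Prod.snd hfix
    rw [ofaceSucc_snd] at this
    exact this

/-- **The three corners of a triangular face** (census socket): at `j` the corner
`corner c j k i`, at `k` the corner `corner c k i j`, at `i` the corner `corner c i j k`
(`q = (i, j)`, `k` the third vertex), and the corner sum is their sum. -/
theorem CensusRows.ofaceCorner_oface_three (h : CensusRows c) {q : Fin 14 × Fin 14}
    (hq : q ∈ darts c) (h3 : ofaceLen c q = 3) :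
    ofaceCorner c q = corner c q.2 (ofaceSucc c q).2 q.1 ∧
      ofaceCorner c (ofaceSucc c q) = corner c (ofaceSucc c q).2 q.1 q.2 ∧
      ofaceCorner c ((ofaceSucc c q).2, q.1) = corner c q.1 q.2 (ofaceSucc c q).2 ∧
      ofaceAngleSum c (ofaceOf c q) = ofaceCorner c q + ofaceCorner c (ofaceSucc c q) +
        ofaceCorner c ((ofaceSucc c q).2, q.1) := by
  obtain ⟨hD3, -, -⟩ := h.intruderDist_bounds
  have hg := h.isGapConfig
  obtain ⟨h2, -, -, -, hn2, hn3⟩ := h.oface_three hq h3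
  have hq1 := hg.ofaceSucc_mem_darts hD3 hq
  have hq2 := hg.ofaceSucc_mem_darts hD3 hq1
  rw [h2] at hq2
  refine ⟨h.ofaceCorner_eq_corner_onextNbr hq, ?_, ?_, ?_⟩
  · rw [h.ofaceCorner_eq_corner_onextNbr hq1, ofaceSucc_fst, hn2]
  · rw [h.ofaceCorner_eq_corner_onextNbr hq2, hn3]
  · rw [ofaceAngleSum_ofaceOf, h3, Finset.sum_range_succ, Finset.sum_range_succ,
      Finset.sum_range_one]
    change ofaceCorner c q + ofaceCorner c (ofaceSucc c q) +
      ofaceCorner c (ofaceSucc c (ofaceSucc c q)) = _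
    rw [h2]

/-- **R-tri on faces, x-triangle: an all-shell triangular face has corner sum `3·α₀`**
(`α₀ = arccos (1/3)`; census socket). -/
theorem CensusRows.ofaceAngleSum_three_shell (h : CensusRows c) {q : Fin 14 × Fin 14}
    (hq : q ∈ darts c) (h3 : ofaceLen c q = 3) (hi : q.1 ≠ 13) (hj : q.2 ≠ 13)
    (hk : (ofaceSucc c q).2 ≠ 13) :
    ofaceAngleSum c (ofaceOf c q) = 3 * Real.arccos (1 / 3) := by
  obtain ⟨-, hik, hdki, hdjk, -, -⟩ := h.oface_three hq h3
  obtain ⟨hc1, hc2, hc3, hsum⟩ := h.ofaceCorner_oface_three hq h3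
  obtain ⟨hi0, hj0, hij, hdij⟩ := dart_data hq
  have hk0 : (ofaceSucc c q).2 ≠ 0 :=
    (dart_data (h.isGapConfig.ofaceSucc_mem_darts h.intruderDist_bounds.1 hq)).2.1
  rw [hsum, hc1, hc2, hc3,
    h.corner_eq_arccos_third q.2 (ofaceSucc c q).2 q.1 hj0 hj hk0 hk hi0 hi hdjk
      (by rw [dist_comm]; exact hdij) hdki,
    h.corner_eq_arccos_third (ofaceSucc c q).2 q.1 q.2 hk0 hk hi0 hi hj0 hj hdki
      (by rw [dist_comm]; exact hdjk) hdij,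
    h.corner_eq_arccos_third q.1 q.2 (ofaceSucc c q).2 hi0 hi hj0 hj hk0 hk hdij
      (by rw [dist_comm]; exact hdki) hdjk]
  ring

/-- **R-tri on faces, p-triangle: a triangular face through the hole dart `(13, j)` has corner
sum `A_p(ρ) + 2·A_x(ρ)`** (`A_p = arccos ((2 − D²)/(4 − D²))`, `A_x = arccos (D/(√3 √(4 − D²)))`,
`D = intruderDist c`; census socket). -/
theorem CensusRows.ofaceAngleSum_three_hole (h : CensusRows c) {q : Fin 14 × Fin 14}
    (hq : q ∈ darts c) (h3 : ofaceLen c q = 3) (hi : q.1 = 13) :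
    ofaceAngleSum c (ofaceOf c q) =
      Real.arccos ((2 - intruderDist c ^ 2) / (4 - intruderDist c ^ 2)) +
        2 * Real.arccos (intruderDist c / (√3 * √(4 - intruderDist c ^ 2))) := by
  obtain ⟨hD3, -, hD2⟩ := h.intruderDist_bounds
  obtain ⟨-, hik, hdki, hdjk, -, -⟩ := h.oface_three hq h3
  obtain ⟨hc1, hc2, hc3, hsum⟩ := h.ofaceCorner_oface_three hq h3
  obtain ⟨hi0, hj0, hij, hdij⟩ := dart_data hq
  have hk0 : (ofaceSucc c q).2 ≠ 0 := (dart_data (h.isGapConfig.ofaceSucc_mem_darts hD3 hq)).2.1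
  rw [hi] at hij hdij hik hdki
  have hj13 : q.2 ≠ 13 := Ne.symm hij
  have hk13 : (ofaceSucc c q).2 ≠ 13 := Ne.symm hik
  rw [hsum, hc1, hc2, hc3, hi,
    h.corner_eq_arccos_Ax q.2 (ofaceSucc c q).2 hj0 hj13 hk0 hk13 hdjk
      (by rw [dist_comm]; exact hdij) hdki,
    corner_comm c (ofaceSucc c q).2 13 q.2,
    h.corner_eq_arccos_Ax (ofaceSucc c q).2 q.2 hk0 hk13 hj0 hj13
      (by rw [dist_comm]; exact hdjk) hdki (by rw [dist_comm]; exact hdij),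
    h.corner_eq_arccos_Ap q.2 (ofaceSucc c q).2 hj0 hj13 hk0 hk13
      (by rw [dist_comm]; exact hdij) hdki hdjk]
  ring

/-! ## Faces of length four are tight quadrilaterals -/

/-- **A face of length `4` is a tight quadrilateral with four distinct vertices.** Under the
census socket, if the face through `q = (i, j)` has length `4`, with `k`, `l` the heads of the
next two darts, then the fourth dart is `(l, i)`, consecutive vertices are at distance `1`, and
`i, j, k, l` are PAIRWISE DISTINCT (the diagonals `i ≠ k`, `j ≠ l` because no vertex has tight
degree `1`). -/
theorem CensusRows.oface_four (h : CensusRows c) {q : Fin 14 × Fin 14} (hq : q ∈ darts c)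
    (h4 : ofaceLen c q = 4) :
    ofaceSucc c (ofaceSucc c (ofaceSucc c q)) = ((ofaceSucc c (ofaceSucc c q)).2, q.1) ∧
      dist (c q.2) (c (ofaceSucc c q).2) = 1 ∧
      dist (c (ofaceSucc c q).2) (c (ofaceSucc c (ofaceSucc c q)).2) = 1 ∧
      dist (c (ofaceSucc c (ofaceSucc c q)).2) (c q.1) = 1 ∧
      q.1 ≠ (ofaceSucc c q).2 ∧ q.2 ≠ (ofaceSucc c (ofaceSucc c q)).2 ∧
      q.1 ≠ (ofaceSucc c (ofaceSucc c q)).2 ∧ q.2 ≠ (ofaceSucc c q).2 ∧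
      onextNbr c q.1 (ofaceSucc c (ofaceSucc c q)).2 = q.2 := by
  obtain ⟨hD3, -, -⟩ := h.intruderDist_bounds
  have hg := h.isGapConfig
  have hfix := iterate_ofaceLen c q
  rw [h4] at hfix
  change ofaceSucc c (ofaceSucc c (ofaceSucc c (ofaceSucc c q))) = q at hfix
  have hq1 := hg.ofaceSucc_mem_darts hD3 hq
  have hq2 := hg.ofaceSucc_mem_darts hD3 hq1
  have hq3 := hg.ofaceSucc_mem_darts hD3 hq2
  have hl : (ofaceSucc c (ofaceSucc c (ofaceSucc c q))).2 = q.1 := by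
    have := congrArg Prod.fst hfix
    rwa [ofaceSucc_fst] at this
  have h3 : ofaceSucc c (ofaceSucc c (ofaceSucc c q)) = ((ofaceSucc c (ofaceSucc c q)).2, q.1) :=
    Prod.ext rfl hl
  rw [h3] at hq3 hfix
  obtain ⟨-, -, hli, hdli⟩ := dart_data hq3
  obtain ⟨-, -, hjk, hdjk⟩ := dart_data hq1
  obtain ⟨-, -, hkl, hdkl⟩ := dart_data hq2
  rw [ofaceSucc_fst] at hjk hdjk hkl hdkl
  -- the diagonals: `k = onextNbr c j i ≠ i`, `l = onextNbr c k j ≠ j`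
  have hi_tn : q.1 ∈ tightNbrs c q.2 := by
    have := snd_mem_tightNbrs_of_mem_darts (swap_mem_darts hq)
    simpa only [Prod.fst_swap, Prod.snd_swap] using this
  have hj_tn : q.2 ∈ tightNbrs c (ofaceSucc c q).2 := by
    have := snd_mem_tightNbrs_of_mem_darts (swap_mem_darts hq1)
    simpa only [Prod.fst_swap, Prod.snd_swap, ofaceSucc_fst] using this
  have hik : q.1 ≠ (ofaceSucc c q).2 := by
    rw [ofaceSucc_snd]
    exact Ne.symm (h.onextNbr_mem_ne (dart_data hq).2.1 hi_tn).2
  have hjl : q.2 ≠ (ofaceSucc c (ofaceSucc c q)).2 := by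
    rw [ofaceSucc_snd, ofaceSucc_fst]
    exact Ne.symm (h.onextNbr_mem_ne (dart_data hq1).2.1 hj_tn).2
  refine ⟨h3, hdjk, hdkl, hdli, hik, hjl, Ne.symm hli, hjk, ?_⟩
  have := congrArg Prod.snd hfix
  rw [ofaceSucc_snd] at this
  exact this

/-- **The four corners of a quadrilateral face** (census socket; `q = (i,j)`, then `k`, `l`):
at `j`: `corner c j k i`; at `k`: `corner c k l j`; at `l`: `corner c l i k`; at `i`:
`corner c i j l`; and the corner sum is their sum. -/
theorem CensusRows.ofaceCorner_oface_four (h : CensusRows c) {q : Fin 14 × Fin 14}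
    (hq : q ∈ darts c) (h4 : ofaceLen c q = 4) :
    ofaceCorner c q = corner c q.2 (ofaceSucc c q).2 q.1 ∧
      ofaceCorner c (ofaceSucc c q) = corner c (ofaceSucc c q).2 (ofaceSucc c (ofaceSucc c q)).2 q.2 ∧
      ofaceCorner c (ofaceSucc c (ofaceSucc c q)) =
        corner c (ofaceSucc c (ofaceSucc c q)).2 q.1 (ofaceSucc c q).2 ∧
      ofaceCorner c ((ofaceSucc c (ofaceSucc c q)).2, q.1) =
        corner c q.1 q.2 (ofaceSucc c (ofaceSucc c q)).2 ∧
      ofaceAngleSum c (ofaceOf c q) = ofaceCorner c q + ofaceCorner c (ofaceSucc c q) +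
        ofaceCorner c (ofaceSucc c (ofaceSucc c q)) +
        ofaceCorner c ((ofaceSucc c (ofaceSucc c q)).2, q.1) := by
  obtain ⟨hD3, -, -⟩ := h.intruderDist_bounds
  have hg := h.isGapConfig
  obtain ⟨h3, -, -, -, -, -, -, -, hn4⟩ := h.oface_four hq h4
  have hq1 := hg.ofaceSucc_mem_darts hD3 hq
  have hq2 := hg.ofaceSucc_mem_darts hD3 hq1
  have hq3 := hg.ofaceSucc_mem_darts hD3 hq2
  rw [h3] at hq3
  refine ⟨h.ofaceCorner_eq_corner_onextNbr hq, ?_, ?_, ?_, ?_⟩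
  · exact h.ofaceCorner_eq_corner_onextNbr hq1
  · rw [h.ofaceCorner_eq_corner_onextNbr hq2, ofaceSucc_fst]
    have : onextNbr c (ofaceSucc c (ofaceSucc c q)).2 (ofaceSucc c q).2 = q.1 := by
      have := congrArg Prod.snd h3
      rw [ofaceSucc_snd, ofaceSucc_fst] at this
      exact this
    rw [this]
  · rw [h.ofaceCorner_eq_corner_onextNbr hq3, hn4]
  · rw [ofaceAngleSum_ofaceOf, h4, Finset.sum_range_succ, Finset.sum_range_succ,
      Finset.sum_range_succ, Finset.sum_range_one]
    change ofaceCorner c q + ofaceCorner c (ofaceSucc c q) + ofaceCorner c (ofaceSucc c (ofaceSucc c q)) +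
      ofaceCorner c (ofaceSucc c (ofaceSucc c (ofaceSucc c q))) = _
    rw [h3]

/-- **R-rhomb on faces: in an all-shell quadrilateral face opposite corners are equal**
(census socket): the corner at `j` equals the corner at `l`, and the corner at `k` equals the
corner at `i` (`q = (i, j)`, then `k`, `l`). -/
theorem CensusRows.ofaceCorner_oface_four_opposite_shell (h : CensusRows c) {q : Fin 14 × Fin 14}
    (hq : q ∈ darts c) (h4 : ofaceLen c q = 4) (hi : q.1 ≠ 13) (hj : q.2 ≠ 13)
    (hk : (ofaceSucc c q).2 ≠ 13) (hl : (ofaceSucc c (ofaceSucc c q)).2 ≠ 13) :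
    ofaceCorner c q = ofaceCorner c (ofaceSucc c (ofaceSucc c q)) ∧
      ofaceCorner c (ofaceSucc c q) = ofaceCorner c ((ofaceSucc c (ofaceSucc c q)).2, q.1) := by
  obtain ⟨hD3, -, -⟩ := h.intruderDist_bounds
  have hg := h.isGapConfig
  obtain ⟨h3, hdjk, hdkl, hdli, -, -, -, -, -⟩ := h.oface_four hq h4
  obtain ⟨hc1, hc2, hc3, hc4, -⟩ := h.ofaceCorner_oface_four hq h4
  obtain ⟨hi0, hj0, -, hdij⟩ := dart_data hq
  have hk0 : (ofaceSucc c q).2 ≠ 0 := (dart_data (hg.ofaceSucc_mem_darts hD3 hq)).2.1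
  have hl0 : (ofaceSucc c (ofaceSucc c q)).2 ≠ 0 :=
    (dart_data (hg.ofaceSucc_mem_darts hD3 (hg.ofaceSucc_mem_darts hD3 hq))).2.1
  constructor
  · -- corners at `j` and at `l`: both touch `k` and `i`
    rw [hc1, hc3, corner_comm c (ofaceSucc c (ofaceSucc c q)).2 q.1]
    exact hg.corner_eq_corner_opposite hj0 hj hl0 hl hk0 hk hi0 hi hdjk
      (by rw [dist_comm]; exact hdij) (by rw [dist_comm]; exact hdkl) hdli
  · -- corners at `k` and at `i`: both touch `l` and `j`
    rw [hc2, hc4, corner_comm c q.1 q.2]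
    exact hg.corner_eq_corner_opposite hk0 hk hi0 hi hl0 hl hj0 hj hdkl
      (by rw [dist_comm]; exact hdjk) (by rw [dist_comm]; exact hdli) hdij

/-- **R-rhomb on faces, diagonal form** (census socket, all-shell quadrilateral face): the
cosine of the corner at `j` is `(4⟪u_k, u_i⟫ − 1)/3` in the diagonal `k–i` (`u = gapDir c`), and
the cosine of the corner at `k` is `(4⟪u_l, u_j⟫ − 1)/3`. -/
theorem CensusRows.cos_ofaceCorner_oface_four_shell (h : CensusRows c) {q : Fin 14 × Fin 14}
    (hq : q ∈ darts c) (h4 : ofaceLen c q = 4) (hi : q.1 ≠ 13) (hj : q.2 ≠ 13)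
    (hk : (ofaceSucc c q).2 ≠ 13) (hl : (ofaceSucc c (ofaceSucc c q)).2 ≠ 13) :
    Real.cos (ofaceCorner c q) =
        (4 * ⟪gapDir c (ofaceSucc c q).2, gapDir c q.1⟫_ℝ - 1) / 3 ∧
      Real.cos (ofaceCorner c (ofaceSucc c q)) =
        (4 * ⟪gapDir c (ofaceSucc c (ofaceSucc c q)).2, gapDir c q.2⟫_ℝ - 1) / 3 := by
  obtain ⟨hD3, -, -⟩ := h.intruderDist_bounds
  have hg := h.isGapConfig
  obtain ⟨-, hdjk, hdkl, -, -, -, -, -, -⟩ := h.oface_four hq h4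
  obtain ⟨hc1, hc2, -, -, -⟩ := h.ofaceCorner_oface_four hq h4
  obtain ⟨hi0, hj0, -, hdij⟩ := dart_data hq
  have hk0 : (ofaceSucc c q).2 ≠ 0 := (dart_data (hg.ofaceSucc_mem_darts hD3 hq)).2.1
  have hl0 : (ofaceSucc c (ofaceSucc c q)).2 ≠ 0 :=
    (dart_data (hg.ofaceSucc_mem_darts hD3 (hg.ofaceSucc_mem_darts hD3 hq))).2.1
  constructor
  · rw [hc1]
    exact hg.cos_corner_rhombus hj0 hj hk0 hk hi0 hi hdjk (by rw [dist_comm]; exact hdij)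
  · rw [hc2]
    exact hg.cos_corner_rhombus hk0 hk hl0 hl hj0 hj hdkl (by rw [dist_comm]; exact hdjk)

/-- **R-quad-p on faces (kite equality): in a quadrilateral face through the hole dart
`(13, j)` the corners at the two shell neighbours `j` and `l` of the hole are equal** (census
socket; the face is the kite `p – x_j – x_k – x_l`). -/
theorem CensusRows.ofaceCorner_oface_four_kite (h : CensusRows c) {q : Fin 14 × Fin 14}
    (hq : q ∈ darts c) (h4 : ofaceLen c q = 4) (hi : q.1 = 13) :
    ofaceCorner c q = ofaceCorner c (ofaceSucc c (ofaceSucc c q)) := by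
  obtain ⟨hD3, -, -⟩ := h.intruderDist_bounds
  have hg := h.isGapConfig
  obtain ⟨h3, hdjk, hdkl, hdli, hik, hjl, hil, -, -⟩ := h.oface_four hq h4
  obtain ⟨hc1, -, hc3, -, -⟩ := h.ofaceCorner_oface_four hq h4
  obtain ⟨hi0, hj0, hij, hdij⟩ := dart_data hq
  have hk0 : (ofaceSucc c q).2 ≠ 0 := (dart_data (hg.ofaceSucc_mem_darts hD3 hq)).2.1
  have hl0 : (ofaceSucc c (ofaceSucc c q)).2 ≠ 0 :=
    (dart_data (hg.ofaceSucc_mem_darts hD3 (hg.ofaceSucc_mem_darts hD3 hq))).2.1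
  rw [hi] at hij hdij hik hil hdli hc1 hc3
  have hj13 : q.2 ≠ 13 := Ne.symm hij
  have hk13 : (ofaceSucc c q).2 ≠ 13 := Ne.symm hik
  have hl13 : (ofaceSucc c (ofaceSucc c q)).2 ≠ 13 := Ne.symm hil
  rw [hc1, hc3, corner_comm c (ofaceSucc c (ofaceSucc c q)).2 13]
  exact hg.kite_corner_eq hj0 hj13 hl0 hl13 hk0 hk13 hdjk (by rw [dist_comm]; exact hdkl)
    (by rw [dist_comm]; exact hdij) hdli

end Summit.Ventures.Crystal3D
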